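import Summits.ABC.ABC.Theorems.ManyPrimeValuationProduct.Negative.WindowCensusFamily

/-!
# `ManyPrimeValuationProduct` (stmt-ABC-1561), line `unramified-window-census` (rev 2): the degenerate
instances of `stub_midCensus` and `stub_giantMass` are false

Negative support (drefute seat `refuter-drefute-stmt-ABC-1561-0`, 2026-08-16), on the Frey family of
`Negative/WindowCensusFamily.lean`. The stub bodies are copied verbatim from the skeleton with the
parameter specialised:

* §2 `stub_midCensus`: `ε = 0` (threshold `(log N)^0`, bound `0·log N + C`) is false
  (`midCensus_false_at_zero`), and no constant serves all `ε > 0` (`midCensus_false_uniform_constant`):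
  on `F(n#, 1)` the census counts every odd prime `≤ n` while `log log N > 1`;
* §3 `stub_giantMass`: `ε = 0` is false (`giantMass_false_at_zero`) and no constant serves all `ε > 0`
  (`giantMass_false_uniform_constant`): on `H(t)` the prime `3` is giant with `log v_3 ≥ log (2t)`.

None of this refutes a stub — both are consequences of the crux (apply it at `ε²`, resp. drop the
non-giant factors of `T`), hence of Szpiro and of ABC; it records the instances every proof must avoid
(`C = C(ε) → ∞`; quantitatively `C(ε) ≳ exp((1/ε) log(2/ε))` for the census, see the drefute notes on the
item, but only `≍ log(1/ε)` per giant prime for the mass).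
-/

noncomputable section

-- `Summit.<Summit>.<Problem>`: for the single-conjunct summit `ABC` the duplicate `ABC.ABC` is mandated.
set_option linter.dupNamespace false

namespace Summit.ABC.ABC.Theorems.ManyPrimeValuationProduct.Negative

open Literature.NumberTheory.EllipticCurves UniqueFactorizationMonoid Real Finset

/-! ## §2 `stub_midCensus`: the degenerate instances `ε = 0` and "one constant for all `ε`"

Witness family `F(n#, 1)`: every odd prime `p ≤ n` is multiplicative with `v_p ≥ 2`, so the census with
threshold exponent `0` counts at least `π(n) − 1` primes, while `log log N > 1`. -/

/-- Real-arithmetic endgame shared by the census kills: a count `cnt ≥ K` with `log log N > 1` cannot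
satisfy `cnt · log log N ≤ 1/2 + C` once `K ≥ C + 3/2`. [folklore] -/
theorem census_endgame {K : ℕ} {C LL cnt : ℝ} (hK : (K : ℝ) ≤ cnt) (hLL : 1 < LL)
    (h : cnt * LL ≤ 1 / 2 + C) (hKC : C + 3 / 2 ≤ K) : False := by
  have hcnt : 0 ≤ cnt := (Nat.cast_nonneg K).trans hK
  have h1 : cnt * 1 ≤ cnt * LL := mul_le_mul_of_nonneg_left hLL.le hcnt
  linarith

/-- **`stub_midCensus` is false at `ε = 0`** (threshold `(log N)^0` and bound `0 · log N + C`): the number of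
multiplicative primes with a non-trivial component group is unbounded on the class. Any proof must use
`ε > 0`. [folklore] -/
theorem midCensus_false_at_zero :
    ¬ ∃ C : ℝ, ∀ (W : WeierstrassCurve ℚ) [W.IsElliptic],
      (∀ p : ℕ, p.Prime → p ≠ 2 → ¬ p ^ 2 ∣ W.conductorNorm ℤ) →
      4 ≤ ((W.conductorNorm ℤ).primeFactors.filter
        (fun p => p ≠ 2 ∧ ¬ p ^ 2 ∣ W.conductorNorm ℤ)).card →
      ((((W.conductorNorm ℤ).primeFactors.filter (fun p => ¬ p ^ 2 ∣ W.conductorNorm ℤ)).filter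
          (fun p => 0 * Real.log (Real.log (W.conductorNorm ℤ)) <
            Real.log ((W.minimalDiscriminantNorm ℤ).factorization p))).card : ℝ) *
        Real.log (Real.log (W.conductorNorm ℤ)) ≤ 0 * Real.log (W.conductorNorm ℤ) + C := by
  rintro ⟨C, hC⟩
  obtain ⟨n, hn11, hK⟩ := exists_many_oddPrimes (⌈C⌉₊ + 2)
  have hM : 1 ≤ primorial n := primorial_pos n
  haveI := family_isElliptic (primorial n) 1 hM
  have h := hC (freyCurve (-1) (32 * ((primorial n : ℕ) : ℤ) ^ 1)) (family_semistable _ 1 hM)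
    (family_four_le_card _ 1 hM le_rfl (dvd_primorial_1155 n hn11))
  -- the census counts every odd prime `≤ n`
  have hcard := family_card_le (primorial n) 1 hM le_rfl ((Nat.primesLE n).filter (· ≠ 2))
    (oddPrimesLE_spec n)
    (fun p => 0 * Real.log (Real.log ((freyCurve (-1) (32 * ((primorial n : ℕ) : ℤ) ^ 1)).conductorNorm ℤ)) <
      Real.log (((freyCurve (-1) (32 * ((primorial n : ℕ) : ℤ) ^ 1)).minimalDiscriminantNorm ℤ).factorization p))
    (fun p _ hv => by
      rw [zero_mul]
      exact Real.log_pos (Nat.one_lt_cast.mpr (by omega)))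
  have hLL := one_lt_loglog (le_trans (by norm_num)
    (family_conductorNorm_ge (primorial n) 1 hM le_rfl (dvd_primorial_1155 n hn11)))
  have hK' := (Nat.cast_le (α := ℝ)).mpr (hK.trans hcard)
  have hC' : C ≤ ⌈C⌉₊ := Nat.le_ceil C
  refine census_endgame (C := C) hK' hLL (le_trans h ?_) ?_
  · rw [zero_mul, zero_add]; linarith
  · push_cast; linarith

/-- **`stub_midCensus` has no constant uniform in `ε`**: `∃ C ∀ ε > 0 …` is false (at a fixed curve let
`ε → 0`: the count tends to the number of multiplicative primes with `v_p ≥ 2`). So `C = C(ε) → ∞` as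
`ε → 0`; see the drefute notes for the quantitative blow-up `C(ε) ≳ exp((1/ε) log (2/ε))`. [folklore] -/
theorem midCensus_false_uniform_constant :
    ¬ ∃ C : ℝ, ∀ ε : ℝ, 0 < ε → ∀ (W : WeierstrassCurve ℚ) [W.IsElliptic],
      (∀ p : ℕ, p.Prime → p ≠ 2 → ¬ p ^ 2 ∣ W.conductorNorm ℤ) →
      4 ≤ ((W.conductorNorm ℤ).primeFactors.filter
        (fun p => p ≠ 2 ∧ ¬ p ^ 2 ∣ W.conductorNorm ℤ)).card →
      ((((W.conductorNorm ℤ).primeFactors.filter (fun p => ¬ p ^ 2 ∣ W.conductorNorm ℤ)).filter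
          (fun p => ε * Real.log (Real.log (W.conductorNorm ℤ)) <
            Real.log ((W.minimalDiscriminantNorm ℤ).factorization p))).card : ℝ) *
        Real.log (Real.log (W.conductorNorm ℤ)) ≤ ε * Real.log (W.conductorNorm ℤ) + C := by
  rintro ⟨C, hC⟩
  obtain ⟨n, hn11, hK⟩ := exists_many_oddPrimes (⌈C⌉₊ + 2)
  have hM : 1 ≤ primorial n := primorial_pos n
  haveI := family_isElliptic (primorial n) 1 hM
  have hN := family_conductorNorm_ge (primorial n) 1 hM le_rfl (dvd_primorial_1155 n hn11)
  -- `L = log N > 3`, `1 < log L ≤ L`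
  have hL3 : 3 < Real.log ((freyCurve (-1) (32 * ((primorial n : ℕ) : ℤ) ^ 1)).conductorNorm ℤ) :=
    lt_of_lt_of_le three_lt_log_21
      (Real.log_le_log (by norm_num) (Nat.cast_le.mpr (le_trans (by norm_num) hN)))
  have hL0 : 0 < Real.log ((freyCurve (-1) (32 * ((primorial n : ℕ) : ℤ) ^ 1)).conductorNorm ℤ) := by
    linarith
  have hLL1 := one_lt_loglog (le_trans (by norm_num) hN)
  have hLLle : Real.log (Real.log ((freyCurve (-1) (32 * ((primorial n : ℕ) : ℤ) ^ 1)).conductorNorm ℤ))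
      ≤ Real.log ((freyCurve (-1) (32 * ((primorial n : ℕ) : ℤ) ^ 1)).conductorNorm ℤ) :=
    (Real.log_le_sub_one_of_pos hL0).trans (by linarith)
  -- ε := 1 / (2L): then ε L = 1/2 and ε log log N ≤ 1/2 < log 2 ≤ log v_p
  have hε : 0 < 1 / (2 * Real.log ((freyCurve (-1) (32 * ((primorial n : ℕ) : ℤ) ^ 1)).conductorNorm ℤ)) := by
    positivity
  have h := hC _ hε (freyCurve (-1) (32 * ((primorial n : ℕ) : ℤ) ^ 1)) (family_semistable _ 1 hM)
    (family_four_le_card _ 1 hM le_rfl (dvd_primorial_1155 n hn11))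
  have hεL : 1 / (2 * Real.log ((freyCurve (-1) (32 * ((primorial n : ℕ) : ℤ) ^ 1)).conductorNorm ℤ))
      * Real.log ((freyCurve (-1) (32 * ((primorial n : ℕ) : ℤ) ^ 1)).conductorNorm ℤ) = 1 / 2 := by
    field_simp
  have hεLL : 1 / (2 * Real.log ((freyCurve (-1) (32 * ((primorial n : ℕ) : ℤ) ^ 1)).conductorNorm ℤ))
      * Real.log (Real.log ((freyCurve (-1) (32 * ((primorial n : ℕ) : ℤ) ^ 1)).conductorNorm ℤ)) ≤ 1 / 2 := by
    rw [div_mul_eq_mul_div, one_mul, div_le_iff₀ (by positivity)]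
    linarith
  have hcard := family_card_le (primorial n) 1 hM le_rfl ((Nat.primesLE n).filter (· ≠ 2))
    (oddPrimesLE_spec n)
    (fun p => 1 / (2 * Real.log ((freyCurve (-1) (32 * ((primorial n : ℕ) : ℤ) ^ 1)).conductorNorm ℤ))
      * Real.log (Real.log ((freyCurve (-1) (32 * ((primorial n : ℕ) : ℤ) ^ 1)).conductorNorm ℤ)) <
      Real.log (((freyCurve (-1) (32 * ((primorial n : ℕ) : ℤ) ^ 1)).minimalDiscriminantNorm ℤ).factorization p))
    (fun p _ hv => by
      have h2 : Real.log 2 ≤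
          Real.log (((freyCurve (-1) (32 * ((primorial n : ℕ) : ℤ) ^ 1)).minimalDiscriminantNorm
            ℤ).factorization p) :=
        Real.log_le_log (by norm_num) (Nat.ofNat_le_cast.mpr (by omega))
      have := Real.log_two_gt_d9
      linarith)
  have hK' := (Nat.cast_le (α := ℝ)).mpr (hK.trans hcard)
  have hC' : C ≤ ⌈C⌉₊ := Nat.le_ceil C
  rw [hεL] at h
  refine census_endgame hK' hLL1 h ?_
  push_cast; linarith

/-! ## §3 `stub_giantMass` (rev 2): the degenerate instances `ε = 0` and "one constant for all `ε`"

Witness family `H(t) = F(385·3^t, 1)` (`Negative/WindowCensusFamily.lean`): `v_3 ≥ 2t > log N` for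
`t ≥ 20`, so `3` is giant and contributes `log v_3 ≥ log (2t)` to the giant mass. -/

/-- **`stub_giantMass` is false at `ε = 0`**: the giant mass `Σ_{p ∥ N, v_p > log N} log v_p` is unbounded on
the class (already one giant prime with `v_3 = 2t` at conductor `≍ 3^t` does it). Any proof must use
`ε > 0`. [folklore] -/
theorem giantMass_false_at_zero :
    ¬ ∃ C : ℝ, ∀ (W : WeierstrassCurve ℚ) [W.IsElliptic],
      (∀ p : ℕ, p.Prime → p ≠ 2 → ¬ p ^ 2 ∣ W.conductorNorm ℤ) →
      4 ≤ ((W.conductorNorm ℤ).primeFactors.filter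
        (fun p => p ≠ 2 ∧ ¬ p ^ 2 ∣ W.conductorNorm ℤ)).card →
      ∑ p ∈ ((W.conductorNorm ℤ).primeFactors.filter (fun p => ¬ p ^ 2 ∣ W.conductorNorm ℤ)).filter
          (fun p => Real.log (W.conductorNorm ℤ) <
            (((W.minimalDiscriminantNorm ℤ).factorization p : ℕ) : ℝ)),
        Real.log ((W.minimalDiscriminantNorm ℤ).factorization p) ≤
          0 * Real.log (W.conductorNorm ℤ) + C := by
  rintro ⟨C, hC⟩
  set t : ℕ := max 20 (⌈Real.exp C⌉₊ + 1) with ht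
  have ht20 : 20 ≤ t := le_max_left _ _
  have hM : 1 ≤ 385 * 3 ^ t := le_trans (Nat.one_le_pow t 3 (by norm_num)) (by omega)
  haveI := family_isElliptic (385 * 3 ^ t) 1 hM
  have h1155 : 1155 ∣ 385 * 3 ^ t :=
    dvd_trans (by norm_num : (1155 : ℕ) ∣ 385 * 3) (mul_dvd_mul_left 385 (dvd_pow_self 3 (by omega)))
  have h := hC (freyCurve (-1) (32 * ((385 * 3 ^ t : ℕ) : ℤ) ^ 1)) (family_semistable _ 1 hM)
    (family_four_le_card _ 1 hM le_rfl h1155)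
  have hmass := familyH_giantMass_ge t ht20
  rw [zero_mul, zero_add] at h
  have hexp : Real.exp C < 2 * t := by
    have h1 : (⌈Real.exp C⌉₊ + 1 : ℝ) ≤ t := by exact_mod_cast le_max_right _ _
    have h2 : Real.exp C ≤ ⌈Real.exp C⌉₊ := Nat.le_ceil _
    have h3 : (0 : ℝ) ≤ t := Nat.cast_nonneg _
    linarith
  have hClt : C < Real.log (2 * t) := by
    rw [Real.lt_log_iff_exp_lt (by positivity)]; exact hexp
  linarith

/-- **`stub_giantMass` has no constant uniform in `ε`** (`∃ C ∀ ε > 0 …` is false: at the fixed curve `H(t)`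
take `ε = 1/log N`). So `C = C(ε) → ∞` as `ε → 0` — though only like `log (1/ε)` per giant prime, and under
ABC at most four primes can be giant; see the drefute notes. [folklore] -/
theorem giantMass_false_uniform_constant :
    ¬ ∃ C : ℝ, ∀ ε : ℝ, 0 < ε → ∀ (W : WeierstrassCurve ℚ) [W.IsElliptic],
      (∀ p : ℕ, p.Prime → p ≠ 2 → ¬ p ^ 2 ∣ W.conductorNorm ℤ) →
      4 ≤ ((W.conductorNorm ℤ).primeFactors.filter
        (fun p => p ≠ 2 ∧ ¬ p ^ 2 ∣ W.conductorNorm ℤ)).card →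
      ∑ p ∈ ((W.conductorNorm ℤ).primeFactors.filter (fun p => ¬ p ^ 2 ∣ W.conductorNorm ℤ)).filter
          (fun p => Real.log (W.conductorNorm ℤ) <
            (((W.minimalDiscriminantNorm ℤ).factorization p : ℕ) : ℝ)),
        Real.log ((W.minimalDiscriminantNorm ℤ).factorization p) ≤
          ε * Real.log (W.conductorNorm ℤ) + C := by
  rintro ⟨C, hC⟩
  set t : ℕ := max 20 (⌈Real.exp (C + 1)⌉₊ + 1) with ht
  have ht20 : 20 ≤ t := le_max_left _ _
  have hM : 1 ≤ 385 * 3 ^ t := le_trans (Nat.one_le_pow t 3 (by norm_num)) (by omega)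
  haveI := family_isElliptic (385 * 3 ^ t) 1 hM
  have h1155 : 1155 ∣ 385 * 3 ^ t :=
    dvd_trans (by norm_num : (1155 : ℕ) ∣ 385 * 3) (mul_dvd_mul_left 385 (dvd_pow_self 3 (by omega)))
  have hN := family_conductorNorm_ge (385 * 3 ^ t) 1 hM le_rfl h1155
  have hL3 : 3 < Real.log ((freyCurve (-1) (32 * ((385 * 3 ^ t : ℕ) : ℤ) ^ 1)).conductorNorm ℤ) :=
    lt_of_lt_of_le three_lt_log_21
      (Real.log_le_log (by norm_num) (Nat.cast_le.mpr (le_trans (by norm_num) hN)))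
  have hL0 : 0 < Real.log ((freyCurve (-1) (32 * ((385 * 3 ^ t : ℕ) : ℤ) ^ 1)).conductorNorm ℤ) := by
    linarith
  have h := hC (1 / Real.log ((freyCurve (-1) (32 * ((385 * 3 ^ t : ℕ) : ℤ) ^ 1)).conductorNorm ℤ))
    (by positivity) (freyCurve (-1) (32 * ((385 * 3 ^ t : ℕ) : ℤ) ^ 1)) (family_semistable _ 1 hM)
    (family_four_le_card _ 1 hM le_rfl h1155)
  have hεL : 1 / Real.log ((freyCurve (-1) (32 * ((385 * 3 ^ t : ℕ) : ℤ) ^ 1)).conductorNorm ℤ)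
      * Real.log ((freyCurve (-1) (32 * ((385 * 3 ^ t : ℕ) : ℤ) ^ 1)).conductorNorm ℤ) = 1 := by
    field_simp
  rw [hεL] at h
  have hmass := familyH_giantMass_ge t ht20
  have hexp : Real.exp (C + 1) < 2 * t := by
    have h1 : (⌈Real.exp (C + 1)⌉₊ + 1 : ℝ) ≤ t := by exact_mod_cast le_max_right _ _
    have h2 : Real.exp (C + 1) ≤ ⌈Real.exp (C + 1)⌉₊ := Nat.le_ceil _
    have h3 : (0 : ℝ) ≤ t := Nat.cast_nonneg _
    linarith
  have hClt : C + 1 < Real.log (2 * t) := by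
    rw [Real.lt_log_iff_exp_lt (by positivity)]; exact hexp
  linarith

end Summit.ABC.ABC.Theorems.ManyPrimeValuationProduct.Negative

end
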